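import Mathlib
import HarnessLib
import Summits.Ventures.LatticeQCDFlow.Exactness.SUNSpectralCouplingLayerShipped
import Summits.Ventures.LatticeQCDFlow.Exactness.KernelCouplingMask

/-!
# The shipped `SU(N)` spectral flow layer ON THE LATTICE: the plaquette coupling layer of `GaugeConfig d L SU(N)` under any mask with frozen staples is an exact transport of `⊗ Haar`

HONEST FRAMING: exact (Metropolis-corrected) sampling algorithms for lattice gauge theory;
figures of merit are autocorrelation/cost numbers at stated couplings and volumes; no
continuum-physics claim.

Venture `LatticeQCDFlow` (cell pub-lqcd), topic `Exactness`; FANOUT row 10 (`eng-equiv`, engine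
`latflow.equiv` `spectral.SUNSpectralCoupling` on `lattice.py` with `masks.py` direction masks; Boyda et
al., PRD 103 (2021) 074504).  NEW WORK of the cell: the lattice corollary of
`SUNSpectralCouplingLayerShipped.hasJacobian_spectralCouplingLayer_sun_shipped` (abstract link set,
abstract measurable staple) through the bridge `KernelCouplingMask.plaquetteKernelLayer_eq_coupleFun`
(frozen staples ⟹ the plaquette kernel layer IS `Theory2.coupleFun` with the staple read off the frozen
links).  It is the `SU(N)` instance of `FlowPushforward.wilson_flow_reweighting_exact`'s hypothesis
`HasJacobian (⊗ Haar) F J` for the engine's layer as shipped — every algebraic hypothesis asked only at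
simple spectra, all data merely measurable.  Nothing is cited as a fact; no number; no definition.

* **`hasJacobian_spectralPlaquetteLayer_sun_shipped`** — lattice `(ℤ/L)^d`, links in `SU(n+1)`,
  reference `⊗_links Haar`; mask `p`, planes `ν` with the three staple links of each active plaquette
  frozen; per active link `e` and frozen links `y` the shipped box flow / eigenvalue map / kernel /
  density data of `hasJacobian_spectralKernel_sun_shipped'`, kernel and density jointly measurable in
  (frozen links, loop) ⟹ the layer `V e ↦ h_e(P) P⁻¹ V e` has
  `HasJacobian (⊗ Haar_{SU(n+1)}) layer (ofReal ∘ coupleJac p (j at the plaquettes))`.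
-/

noncomputable section

namespace Summit.Ventures.LatticeQCDFlow.Exactness

open MeasureTheory Matrix Set Real Finset
open Literature.LinearAlgebra.Matrix
open Literature.MathematicalPhysics.QuantumFieldTheory
open scoped ENNReal

variable {n d L : ℕ} [NeZero L]

section Lattice

variable {φ Z : (Fin n → ℝ) → (Fin n → ℝ)}
  (hφ : ∀ a i, φ a i = a i * ∏ j ∈ Finset.Iio i, (1 - a j))
  (hZ : ∀ ρ i, Z ρ i = -(2 * π / (n + 1)) * (∑ k : Fin n, ((n : ℝ) - k) * ρ k) + 2 * π * ∑ k ∈ Finset.Iio i, ρ k)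
  (p : Edge d L → Prop) [DecidablePred p] (ν : Edge d L → Fin d)
  (h1 : ∀ e, p e → ¬p (e.1.shift e.2, ν e)) (h2 : ∀ e, p e → ¬p (e.1.shift (ν e), e.2))
  (h3 : ∀ e, p e → ¬p (e.1, ν e))

include hφ hZ

/-- **Boyda's `SU(N)` spectral flow layer as shipped, on the lattice, is exact for `⊗ Haar`.**  Mask
`p` / planes `ν` with frozen staples (`h1`–`h3`; e.g. the engine's direction masks,
`KernelCouplingMask.directionMask_*_frozen`); kernel field `hol V e = h e (V|frozen)`; per active link
`e` and frozen links `y`: box flow `χ e y` on `(0,1)ⁿ` with `HasJacobian (Leb|_B)` and `χ(B) ⊆ B`,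
shipped eigenvalue map `f e y` (measurable; permutation-equivariant / unimodular / unit product at
INJECTIVE unimodular spectra; given on the box through the cell charts), shipped kernel `h e y`
following the recipe at simple spectra, spectral datum `JD e y` with the booked box value, shipped
density `j e y ≥ 0` with `ofReal (j e y W) = JD e y d` at simple spectra; `h e`, `j e` jointly measurable
in (frozen links, loop).  Then
`HasJacobian (⊗ Haar) (V e ↦ hol V e (P) P⁻¹ V e on active links) (ofReal ∘ coupleJac p (j at the plaquettes))`. -/
theorem hasJacobian_spectralPlaquetteLayer_sun_shipped
    (hol : GaugeConfig d L (Matrix.specialUnitaryGroup (Fin (n + 1)) ℂ) → Edge d L →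
      Matrix.specialUnitaryGroup (Fin (n + 1)) ℂ → Matrix.specialUnitaryGroup (Fin (n + 1)) ℂ)
    (h : Edge d L → ({f : Edge d L // ¬p f} → Matrix.specialUnitaryGroup (Fin (n + 1)) ℂ) →
      Matrix.specialUnitaryGroup (Fin (n + 1)) ℂ → Matrix.specialUnitaryGroup (Fin (n + 1)) ℂ)
    (hHV : ∀ V e, p e → hol V e = h e (fun f => V f))
    (f : Edge d L → ({f : Edge d L // ¬p f} → Matrix.specialUnitaryGroup (Fin (n + 1)) ℂ) →
      (Fin (n + 1) → ℂ) → (Fin (n + 1) → ℂ))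
    (hfm : ∀ e y, Measurable (f e y))
    (hfperm : ∀ e y (σ : Equiv.Perm (Fin (n + 1))) (dg : Fin (n + 1) → ℂ), (∀ i, ‖dg i‖ = 1) →
      Function.Injective dg → f e y (fun i => dg (σ i)) = fun i => f e y dg (σ i))
    (χ : Edge d L → ({f : Edge d L // ¬p f} → Matrix.specialUnitaryGroup (Fin (n + 1)) ℂ) →
      (Fin n → ℝ) → (Fin n → ℝ))
    (Jχ : Edge d L → ({f : Edge d L // ¬p f} → Matrix.specialUnitaryGroup (Fin (n + 1)) ℂ) →
      (Fin n → ℝ) → ℝ≥0∞)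
    (hχ : ∀ e y, HasJacobian ((volume : Measure (Fin n → ℝ)).restrict (Set.pi univ fun _ : Fin n => Ioo (0 : ℝ) 1))
      (χ e y) (Jχ e y))
    (hχbox : ∀ e y, ∀ b ∈ Set.pi univ (fun _ : Fin n => Ioo (0 : ℝ) 1),
      χ e y b ∈ Set.pi univ fun _ : Fin n => Ioo (0 : ℝ) 1)
    (hfG : ∀ e y, ∀ b ∈ Set.pi univ (fun _ : Fin n => Ioo (0 : ℝ) 1),
      f e y (fun i => (Circle.exp ((Fin.snoc (Z (φ b)) (-∑ k, Z (φ b) k) : Fin (n + 1) → ℝ) i) : ℂ)) =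
        fun i => (Circle.exp ((Fin.snoc (Z (φ (χ e y b))) (-∑ k, Z (φ (χ e y b)) k) : Fin (n + 1) → ℝ) i) : ℂ))
    (hhm : ∀ e, Measurable fun q : ({f : Edge d L // ¬p f} → Matrix.specialUnitaryGroup (Fin (n + 1)) ℂ) ×
      Matrix.specialUnitaryGroup (Fin (n + 1)) ℂ => h e q.1 q.2)
    (hagree : ∀ e y (Q : Matrix.specialUnitaryGroup (Fin (n + 1)) ℂ) (V : Matrix (Fin (n + 1)) (Fin (n + 1)) ℂ)
      (dg : Fin (n + 1) → ℂ), V ∈ Matrix.unitaryGroup (Fin (n + 1)) ℂ → Function.Injective dg →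
        (Q : Matrix (Fin (n + 1)) (Fin (n + 1)) ℂ) = V * diagonal dg * star V →
        ((h e y Q : Matrix.specialUnitaryGroup (Fin (n + 1)) ℂ) : Matrix (Fin (n + 1)) (Fin (n + 1)) ℂ) =
          V * diagonal (f e y dg) * star V)
    (hf1 : ∀ e y (dg : Fin (n + 1) → ℂ), (∀ i, ‖dg i‖ = 1) → Function.Injective dg → ∀ i, ‖f e y dg i‖ = 1)
    (hfdet : ∀ e y (dg : Fin (n + 1) → ℂ), (∀ i, ‖dg i‖ = 1) → Function.Injective dg → ∏ i, dg i = 1 →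
      ∏ i, f e y dg i = 1)
    (JD : Edge d L → ({f : Edge d L // ¬p f} → Matrix.specialUnitaryGroup (Fin (n + 1)) ℂ) →
      (Fin (n + 1) → ℂ) → ℝ≥0∞)
    (hJDm : ∀ e y, Measurable (JD e y))
    (hJDperm : ∀ e y (σ : Equiv.Perm (Fin (n + 1))) (dg : Fin (n + 1) → ℂ), Function.Injective dg →
      JD e y (fun i => dg (σ i)) = JD e y dg)
    (hJchart : ∀ e y, ∀ b ∈ Set.pi univ (fun _ : Fin n => Ioo (0 : ℝ) 1),
      JD e y (fun i => (Circle.exp ((Fin.snoc (Z (φ b)) (-∑ k, Z (φ b) k) : Fin (n + 1) → ℝ) i) : ℂ)) *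
          ENNReal.ofReal ((∏ i, ∏ k ∈ Finset.univ.erase i,
            ‖(Circle.exp ((Fin.snoc (Z (φ b)) (-∑ k, Z (φ b) k) : Fin (n + 1) → ℝ) i) : ℂ) -
              (Circle.exp ((Fin.snoc (Z (φ b)) (-∑ k, Z (φ b) k) : Fin (n + 1) → ℝ) k) : ℂ)‖) /
                (Fintype.card (Fin (n + 1))).factorial) =
        (ENNReal.ofReal |∏ i : Fin n, ∏ j ∈ Finset.Iio i, (1 - (χ e y b) j)| * Jχ e y b /
            ENNReal.ofReal |∏ i : Fin n, ∏ j ∈ Finset.Iio i, (1 - b j)|) *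
          ENNReal.ofReal ((∏ i, ∏ k ∈ Finset.univ.erase i,
            ‖(Circle.exp ((Fin.snoc (Z (φ (χ e y b))) (-∑ k, Z (φ (χ e y b)) k) : Fin (n + 1) → ℝ) i) : ℂ) -
              (Circle.exp ((Fin.snoc (Z (φ (χ e y b))) (-∑ k, Z (φ (χ e y b)) k) : Fin (n + 1) → ℝ) k) : ℂ)‖) /
                (Fintype.card (Fin (n + 1))).factorial))
    (j : Edge d L → ({f : Edge d L // ¬p f} → Matrix.specialUnitaryGroup (Fin (n + 1)) ℂ) →
      Matrix.specialUnitaryGroup (Fin (n + 1)) ℂ → ℝ)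
    (hj0 : ∀ e y g, 0 ≤ j e y g)
    (hjm : ∀ e, Measurable fun q : ({f : Edge d L // ¬p f} → Matrix.specialUnitaryGroup (Fin (n + 1)) ℂ) ×
      Matrix.specialUnitaryGroup (Fin (n + 1)) ℂ => j e q.1 q.2)
    (hJspec : ∀ e y (W : Matrix.specialUnitaryGroup (Fin (n + 1)) ℂ) (V : Matrix (Fin (n + 1)) (Fin (n + 1)) ℂ)
      (dg : Fin (n + 1) → ℂ), V ∈ Matrix.unitaryGroup (Fin (n + 1)) ℂ → Function.Injective dg →
        (W : Matrix (Fin (n + 1)) (Fin (n + 1)) ℂ) = V * diagonal dg * star V →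
        ENNReal.ofReal (j e y W) = JD e y dg) :
    HasJacobian (Measure.pi fun _ : Edge d L => haarProbability (Matrix.specialUnitaryGroup (Fin (n + 1)) ℂ))
      (fun (V : GaugeConfig d L (Matrix.specialUnitaryGroup (Fin (n + 1)) ℂ)) (e : Edge d L) =>
        if p e then hol V e (plaquetteHolonomy V e.1 e.2 (ν e)) * (plaquetteHolonomy V e.1 e.2 (ν e))⁻¹ * V e
        else V e)
      fun V => ENNReal.ofReal (Theory2.coupleJac p (fun a y u =>
        j a.1 y (u * (y ⟨_, h1 a.1 a.2⟩ * (y ⟨_, h2 a.1 a.2⟩)⁻¹ * (y ⟨_, h3 a.1 a.2⟩)⁻¹))) V) := by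
  haveI : SecondCountableTopology (Matrix (Fin (n + 1)) (Fin (n + 1)) ℂ) :=
    inferInstanceAs (SecondCountableTopology (Fin (n + 1) → Fin (n + 1) → ℂ))
  haveI : SecondCountableTopology (Matrix.specialUnitaryGroup (Fin (n + 1)) ℂ) :=
    Topology.IsEmbedding.subtypeVal.secondCountableTopology
  -- the frozen staple is a measurable function of the frozen links
  have hev : ∀ f₀ : {f : Edge d L // ¬p f},
      Measurable fun y : ({f : Edge d L // ¬p f} → Matrix.specialUnitaryGroup (Fin (n + 1)) ℂ) => y f₀ :=
    fun f₀ => measurable_pi_apply f₀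
  have hS : ∀ a : {e // p e},
      Measurable fun y : ({f : Edge d L // ¬p f} → Matrix.specialUnitaryGroup (Fin (n + 1)) ℂ) =>
        y ⟨_, h1 a.1 a.2⟩ * (y ⟨_, h2 a.1 a.2⟩)⁻¹ * (y ⟨_, h3 a.1 a.2⟩)⁻¹ := fun a =>
    ((hev _).mul (hev _).inv).mul (hev _).inv
  rw [plaquetteKernelLayer_eq_coupleFun p ν hol h hHV h1 h2 h3]
  exact hasJacobian_spectralCouplingLayer_sun_shipped hφ hZ p
    (fun a y => y ⟨_, h1 a.1 a.2⟩ * (y ⟨_, h2 a.1 a.2⟩)⁻¹ * (y ⟨_, h3 a.1 a.2⟩)⁻¹) hS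
    (fun a y => f a.1 y) (fun a y => hfm a.1 y) (fun a y => hfperm a.1 y)
    (fun a y => χ a.1 y) (fun a y => Jχ a.1 y) (fun a y => hχ a.1 y) (fun a y => hχbox a.1 y) (fun a y => hfG a.1 y)
    (fun a y => h a.1 y) (fun a => hhm a.1) (fun a y => hagree a.1 y) (fun a y => hf1 a.1 y) (fun a y => hfdet a.1 y)
    (fun a y => JD a.1 y) (fun a y => hJDm a.1 y) (fun a y => hJDperm a.1 y) (fun a y => hJchart a.1 y)
    (fun a y => j a.1 y) (fun a y g => hj0 a.1 y g) (fun a => hjm a.1) (fun a y => hJspec a.1 y)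

end Lattice

end Summit.Ventures.LatticeQCDFlow.Exactness
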